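import Summits.QuantumFields.YangMills.Theorems.ColdStartUniversalityLatticeLangevinHypercontractivityExplicit
import Summits.QuantumFields.YangMills.Theorems.ColdStartUniversalityLatticeLangevinWilsonExplicitGap
import Summits.QuantumFields.YangMills.Theorems.ColdStartUniversalityLatticeLangevinBakryEmeryUniformGap
import Summits.QuantumFields.YangMills.Theorems.ColdStartUniversalityLatticeLangevinWilsonSpectralGapColdStartEvents
import HarnessLib

/-!
# Route `ColdStartUniversality` (fixed-cut-off package, `Lᵖ` side): ★★★ HYPERCONTRACTIVE `L²`-MIXING of the SZZ dynamics from a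
# dominated initial law — the burn-in cost `log D` of the Poincaré bound becomes `log log D` (Diaconis–Saloff-Coste Theorem 3.7)

Helper file (seat `ym-line-csu-p1`, g36; `--supports stmt-QuantumFields-24809`).  SU(2) lattice Langevin dynamics of Shen–Zhu–Zhu at
`(L, β')`, Wilson measure `μ = μ_{β'}`, ANY realising kernel family `κ`.  The tree's cold-start `L²` mixing
(`coldStart_measurable_sq_sub_le_exp_explicit`, g16/g19/g25) reads, for an initial law `ν ≤ D·μ`:
`|∫ κ_tF dν − μF| ≤ √D · e^{−λt} · √Var_μ(F)` — the density bound `D` (for the cold start `log D = O(L³)`, g27) is paid as `log D/(2λ)`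
lattice time.  HYPERCONTRACTIVITY (g36, `lqNorm_transition_le_of_generatorLogSobolev_of_measurable`) replaces `√D` by `D^{1/q}` at the
price of the waiting time `t₀` with `q = 1 + e^{4ρt₀}`; at `t₀ = log log D/(4ρ)` one has `q − 1 = log D` and `D^{1/q} ≤ e`:

* `rpow_integral_abs_le_mul_integral_of_le_smul` — Jensen against a dominated law: `(∫ |G| dν)^q ≤ D·∫ |G|^q dμ` (`ν ≤ D·μ`, `q ≥ 1`);
* `integral_transition_transition_eq_of_measurable` — `κ_h(κ_t G) = κ_{t+h} G` pointwise for bounded measurable `G`;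
* ★★ `abs_integral_transition_sub_le_of_hypercontractive` — under LSI(`ρ`) and an `L²` gap `λ` (both as hypotheses): for `ν ≤ D·μ`
  a probability measure, bounded measurable `F`, `t₀, s ≥ 0` and `q = 1 + e^{4ρt₀}`:
  `|∫ κ_{t₀+s}F dν − μF| ≤ D^{1/q} · e^{−λs} · √Var_μ(F)`;
* ★★★ `wilson_hypercontractive_mixing_explicit` — UNCONDITIONAL at every `(L, β')` (`ρ = ½e^{−4|β'|#𝒫}`, `λ = (3/2)e^{−4|β'|#𝒫}`):
  for `D ≥ e` and `t₀ = log log D/(4ρ)`:  `|∫ κ_{t₀+s}F dν − μF| ≤ e · e^{−λs} · √Var_μ(F)`;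
* ★★★ `wilson_hypercontractive_mixing_uniform` — `|β'| < 1/12`: the same with the VOLUME-FREE `ρ = (1−12|β'|)/2`, `λ = 1 − 12|β'|`:
  the `L²`/χ²-mixing time from a law with `log D = O(L³)` is `log log D/(4ρ) + (1 + log(1/ε))/λ = O(log L)` lattice units, against
  `O(L³)` from the Poincaré inequality alone (the entropy route of g27 gives the same order for the weaker total-variation distance).

THEOREMS ONLY, no definition, no sorry.  HONEST FRAMING: RECORD-rung R3 plumbing at FIXED cut-off; the volume-free window `|β'| < 1/12`
is the high-temperature regime, not the route's scaling `β'_K → ∞`; nothing K-uniform is proved; no crux, rung or summit statement is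
proved; the Yang–Mills mass gap is NOT proved.
-/

set_option autoImplicit false

noncomputable section

namespace Summit.QuantumFields.YangMills.Theorems.ColdStartUniversality

open MeasureTheory ProbabilityTheory Filter Set Topology
open scoped BigOperators NNReal ENNReal
open Literature.Probability.Process Literature.MathematicalPhysics.QuantumFieldTheory
open Literature.MathematicalPhysics.QuantumLattice (fundamentalRep fundamentalLatticeRep continuous_fundamentalRep)

variable {L : ℕ} [NeZero L]

/-! ## §1. Jensen against a dominated law and Chapman–Kolmogorov on bounded measurable observables -/

/-- **Jensen against a dominated law**: if `ν` is a probability measure with `ν ≤ D·μ` (`μ` finite, `D ≥ 0`), `G` is bounded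
measurable and `q ≥ 1`, then `(∫ |G| dν)^q ≤ D·∫ |G|^q dμ` (`(∫|G|dν)^q ≤ ∫|G|^q dν` by convexity of `x ↦ x^q` on `[0,∞)`, then
the domination).  The `L^q` twin of `sq_integral_le_mul_integral_sq_of_measurable`. [folklore] -/
theorem rpow_integral_abs_le_mul_integral_of_le_smul {Y : Type*} [MeasurableSpace Y] {ν μ : Measure Y}
    [IsProbabilityMeasure ν] [IsFiniteMeasure μ] {D : ℝ} (hD : 0 ≤ D) (hle : ν ≤ (ENNReal.ofReal D) • μ)
    {G : Y → ℝ} (hG : Measurable G) {C : ℝ} (hC : ∀ y, |G y| ≤ C) {q : ℝ} (hq : 1 ≤ q) :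
    (∫ y, |G y| ∂ν) ^ q ≤ D * ∫ y, |G y| ^ q ∂μ := by
  have hq0 : 0 ≤ q := by linarith
  -- Jensen on `ν`
  have hGa : Measurable fun y => |G y| := hG.abs
  have hGaq : Measurable fun y => |G y| ^ q := (Real.continuous_rpow_const hq0).measurable.comp hGa
  have hbound_q : ∀ y, |(|G y| ^ q)| ≤ |C| ^ q := fun y => by
    rw [abs_of_nonneg (Real.rpow_nonneg (abs_nonneg _) q)]
    exact Real.rpow_le_rpow (abs_nonneg _) ((hC y).trans (le_abs_self C)) hq0
  have i1 : Integrable (fun y => |G y|) ν := integrable_of_abs_le ν hGa (C := C) fun y => by rw [abs_abs]; exact hC y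
  have i2 : Integrable (fun y => |G y| ^ q) ν := integrable_of_abs_le ν hGaq hbound_q
  have hJ := ConvexOn.map_integral_le (μ := ν) (f := fun y => |G y|) (convexOn_rpow hq)
    (Real.continuous_rpow_const hq0).continuousOn isClosed_Ici (Eventually.of_forall fun y => abs_nonneg (G y)) i1 i2
  -- domination
  have i3 : Integrable (fun y => |G y| ^ q) ((ENNReal.ofReal D) • μ) := (integrable_of_abs_le μ hGaq hbound_q).smul_measure
    ENNReal.ofReal_ne_top
  have h2 : ∫ y, |G y| ^ q ∂ν ≤ ∫ y, |G y| ^ q ∂((ENNReal.ofReal D) • μ) :=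
    integral_mono_measure hle (Eventually.of_forall fun y => Real.rpow_nonneg (abs_nonneg _) q) i3
  rw [integral_smul_measure, ENNReal.toReal_ofReal hD, smul_eq_mul] at h2
  exact hJ.trans h2

/-- **`κ_h(κ_t G) = κ_{t+h} G` pointwise for bounded measurable `G`** and any realising kernel family (Chapman–Kolmogorov
`κ_{h+t} = κ_t ∘ₖ κ_h`; the measurable twin of `transition_transition_cylinder_eq`). [cite: ShenZhuZhu2022, §3 (Markov semigroup after Lemma 3.3, p. 13)] -/
theorem integral_transition_transition_eq_of_measurable (L : ℕ) [NeZero L] (β' : ℝ)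
    (κ : ℝ≥0 → Kernel (GaugeConfig 3 L (Matrix.specialUnitaryGroup (Fin 2) ℂ))
      (GaugeConfig 3 L (Matrix.specialUnitaryGroup (Fin 2) ℂ))) [∀ t, IsMarkovKernel (κ t)]
    (hreal : ∀ (t : ℝ≥0) (x : GaugeConfig 3 L (Matrix.specialUnitaryGroup (Fin 2) ℂ))
        (Ω : Type) [MeasurableSpace Ω] (P : Measure Ω) [IsProbabilityMeasure P]
        (W : ℝ≥0 → Ω → (Edge 3 L × NoiseIdx 2 → ℝ)) (hW : IsFlatBrownian W P)
        (U : ℝ≥0 → Ω → GaugeConfig 3 L (Matrix.specialUnitaryGroup (Fin 2) ℂ)),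
        (∀ ω, U 0 ω = x) →
        (latticeLangevinDynamics (fundamentalLatticeRep 2) β').IsSolution (fundamentalRep (Fin 2))
          hW.natFiltration P W U →
        κ t x = P.map (U t))
    {G : GaugeConfig 3 L (Matrix.specialUnitaryGroup (Fin 2) ℂ) → ℝ} (hG : Measurable G) {M : ℝ} (hM : ∀ x, |G x| ≤ M)
    (t h : ℝ≥0) (x : GaugeConfig 3 L (Matrix.specialUnitaryGroup (Fin 2) ℂ)) :
    ∫ y, (∫ z, G z ∂(κ t y)) ∂(κ h x) = ∫ z, G z ∂(κ (t + h) x) := by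
  classical
  have hCK : κ (h + t) = κ t ∘ₖ κ h := chapmanKolmogorov_szz β' κ hreal h t
  rw [add_comm t h, hCK]
  haveI : IsProbabilityMeasure ((κ t ∘ₖ κ h) x) := by rw [← hCK]; infer_instance
  exact (Kernel.integral_comp (integrable_of_abs_le _ hG hM)).symm

/-! ## §2. Hypercontractive `L²`-mixing from a dominated initial law -/

/-- ★★ **Hypercontractive `L²`-mixing, conditional form.**  Under the generator-form log-Sobolev inequality with constant `ρ ≥ 0` and
an `L²` spectral gap `λ` for bounded measurable observables (both HYPOTHESES here), for every probability measure `ν ≤ D·μ_{β'}`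
(`D ≥ 0`), every bounded measurable `F`, every `t₀, s ≥ 0` and `q = 1 + e^{4ρt₀}`:

  `|∫ κ_{t₀+s}F dν − ∫ F dμ_{β'}| ≤ D^{1/q} · e^{−λs} · (∫ (F − μF)² dμ_{β'})^{1/2}`

(Chapman–Kolmogorov `κ_{t₀+s} = κ_{t₀}κ_s`, Jensen against `ν ≤ D·μ` in `L^q`, hypercontractivity `‖κ_{t₀}‖_{2→q} ≤ 1`, the gap on
`κ_s(F − μF)`). [cite: DiaconisSaloffcoste1996, Theorem 3.7] -/
theorem abs_integral_transition_sub_le_of_hypercontractive (L : ℕ) [NeZero L] (β' : ℝ)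
    (κ : ℝ≥0 → Kernel (GaugeConfig 3 L (Matrix.specialUnitaryGroup (Fin 2) ℂ))
      (GaugeConfig 3 L (Matrix.specialUnitaryGroup (Fin 2) ℂ))) [∀ t, IsMarkovKernel (κ t)]
    (hreal : ∀ (t : ℝ≥0) (x : GaugeConfig 3 L (Matrix.specialUnitaryGroup (Fin 2) ℂ))
        (Ω : Type) [MeasurableSpace Ω] (P : Measure Ω) [IsProbabilityMeasure P]
        (W : ℝ≥0 → Ω → (Edge 3 L × NoiseIdx 2 → ℝ)) (hW : IsFlatBrownian W P)
        (U : ℝ≥0 → Ω → GaugeConfig 3 L (Matrix.specialUnitaryGroup (Fin 2) ℂ)),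
        (∀ ω, U 0 ω = x) →
        (latticeLangevinDynamics (fundamentalLatticeRep 2) β').IsSolution (fundamentalRep (Fin 2))
          hW.natFiltration P W U →
        κ t x = P.map (U t))
    {ρ : ℝ} (hρ : 0 ≤ ρ)
    (hLSgen : ∀ (f : (Edge 3 L × Fin 2 × Fin 2 × Bool → ℝ) → ℝ), ContDiff ℝ 3 f →
        let coords : GaugeConfig 3 L (Matrix.specialUnitaryGroup (Fin 2) ℂ) → (Edge 3 L × Fin 2 × Fin 2 × Bool → ℝ) :=
          fun V q => (fun z : ℂ => if q.2.2.2 then z.im else z.re)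
            ((fundamentalRep (Fin 2) (V q.1) : Matrix (Fin 2) (Fin 2) ℂ) q.2.1 q.2.2.1)
        let gen : GaugeConfig 3 L (Matrix.specialUnitaryGroup (Fin 2) ℂ) → ℝ := fun V =>
          (∑ i : Edge 3 L × Fin 2 × Fin 2 × Bool, fderiv ℝ f (coords V) (Pi.single i 1) *
              (fun z : ℂ => if i.2.2.2 then z.im else z.re)
                ((latticeLangevinDynamics (fundamentalLatticeRep 2) β').drift
                  (matrixConfig (fundamentalRep (Fin 2)) V) i.1 i.2.1 i.2.2.1) +
          1 / 2 * ∑ i : Edge 3 L × Fin 2 × Fin 2 × Bool, ∑ j : Edge 3 L × Fin 2 × Fin 2 × Bool,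
            fderiv ℝ (fun z => fderiv ℝ f z (Pi.single i 1)) (coords V) (Pi.single j 1) *
              ∑ n : Edge 3 L × NoiseIdx 2,
                (if n.1 = i.1 then (fun z : ℂ => if i.2.2.2 then z.im else z.re)
                  ((latticeLangevinDynamics (fundamentalLatticeRep 2) β').noise
                    (matrixConfig (fundamentalRep (Fin 2)) V) i.1 n.2 i.2.1 i.2.2.1) else 0) *
                (if n.1 = j.1 then (fun z : ℂ => if j.2.2.2 then z.im else z.re)
                  ((latticeLangevinDynamics (fundamentalLatticeRep 2) β').noise
                    (matrixConfig (fundamentalRep (Fin 2)) V) j.1 n.2 j.2.1 j.2.2.1) else 0))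
        ρ * ((∫ V, f (coords V) ^ 2 * Real.log (f (coords V) ^ 2) ∂(wilsonMeasure (d := 3) (L := L) (fundamentalRep (Fin 2)) β')) -
            (∫ V, f (coords V) ^ 2 ∂(wilsonMeasure (d := 3) (L := L) (fundamentalRep (Fin 2)) β')) *
              Real.log (∫ V, f (coords V) ^ 2 ∂(wilsonMeasure (d := 3) (L := L) (fundamentalRep (Fin 2)) β'))) ≤
          -∫ V, f (coords V) * gen V ∂(wilsonMeasure (d := 3) (L := L) (fundamentalRep (Fin 2)) β'))
    {lam : ℝ}
    (hgap : ∀ (G : GaugeConfig 3 L (Matrix.specialUnitaryGroup (Fin 2) ℂ) → ℝ), Measurable G → ∀ M : ℝ, (∀ x, |G x| ≤ M) →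
      ∀ t : ℝ≥0,
        ∫ x, ((∫ y, G y ∂(κ t x)) - ∫ z, G z ∂(wilsonMeasure (d := 3) (L := L) (fundamentalRep (Fin 2)) β')) ^ 2
            ∂(wilsonMeasure (d := 3) (L := L) (fundamentalRep (Fin 2)) β') ≤
          Real.exp (-2 * lam * t) *
            ∫ x, (G x - ∫ z, G z ∂(wilsonMeasure (d := 3) (L := L) (fundamentalRep (Fin 2)) β')) ^ 2
              ∂(wilsonMeasure (d := 3) (L := L) (fundamentalRep (Fin 2)) β'))
    {ν : Measure (GaugeConfig 3 L (Matrix.specialUnitaryGroup (Fin 2) ℂ))} [IsProbabilityMeasure ν] {D : ℝ} (hD : 0 ≤ D)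
    (hν : ν ≤ (ENNReal.ofReal D) • wilsonMeasure (d := 3) (L := L) (fundamentalRep (Fin 2)) β')
    {F : GaugeConfig 3 L (Matrix.specialUnitaryGroup (Fin 2) ℂ) → ℝ} (hF : Measurable F) {M : ℝ} (hM : ∀ x, |F x| ≤ M)
    (t₀ s : ℝ≥0) :
    |(∫ x, (∫ y, F y ∂(κ (t₀ + s) x)) ∂ν) - ∫ x, F x ∂(wilsonMeasure (d := 3) (L := L) (fundamentalRep (Fin 2)) β')| ≤
      D ^ (1 / (1 + Real.exp (4 * ρ * t₀))) * Real.exp (-lam * s) *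
        (∫ x, (F x - ∫ z, F z ∂(wilsonMeasure (d := 3) (L := L) (fundamentalRep (Fin 2)) β')) ^ 2
          ∂(wilsonMeasure (d := 3) (L := L) (fundamentalRep (Fin 2)) β')) ^ (1 / (2 : ℝ)) := by
  classical
  haveI := secondCountableTopology_su2
  haveI := borelSpace_config L
  set μ : Measure (GaugeConfig 3 L (Matrix.specialUnitaryGroup (Fin 2) ℂ)) :=
    wilsonMeasure (d := 3) (L := L) (fundamentalRep (Fin 2)) β' with hμ
  haveI : IsProbabilityMeasure μ :=
    isProbabilityMeasure_wilsonMeasure (d := 3) (L := L) (fundamentalRep (Fin 2)) (continuous_fundamentalRep (Fin 2)) β'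
  set q : ℝ := 1 + Real.exp (4 * ρ * t₀) with hq
  have hq1 : 1 < q := by have := Real.exp_pos (4 * ρ * t₀); rw [hq]; linarith
  have hq0 : 0 < q := by linarith
  set m : ℝ := ∫ x, F x ∂μ with hm
  -- the centred observable after the gap phase: `G = κ_s(F − m)`, i.e. `G x = κ_sF(x) − m`
  set G : GaugeConfig 3 L (Matrix.specialUnitaryGroup (Fin 2) ℂ) → ℝ := fun x => (∫ y, F y ∂(κ s x)) - m with hG
  have hκFm : Measurable fun x => ∫ y, F y ∂(κ s x) := (hF.stronglyMeasurable.integral_kernel (κ := κ s)).measurable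
  have hGm : Measurable G := hκFm.sub measurable_const
  have hGb : ∀ x, |G x| ≤ M + M := fun x =>
    (abs_sub _ _).trans (add_le_add (abs_integral_le_of_abs_le_of_isProbabilityMeasure (μ := κ s x) hM)
      (by rw [hm]; exact abs_integral_le_of_abs_le_of_isProbabilityMeasure (μ := μ) hM))
  -- Chapman–Kolmogorov: `∫ κ_{t₀+s}F dν − m = ∫ κ_{t₀} G dν`
  have hKGm : Measurable fun x => ∫ y, G y ∂(κ t₀ x) := (hGm.stronglyMeasurable.integral_kernel (κ := κ t₀)).measurable
  have hKGb : ∀ x, |∫ y, G y ∂(κ t₀ x)| ≤ M + M := fun x => abs_integral_le_of_abs_le_of_isProbabilityMeasure (μ := κ t₀ x) hGb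
  have hCK : ∀ x, (∫ y, F y ∂(κ (t₀ + s) x)) - m = ∫ y, G y ∂(κ t₀ x) := by
    intro x
    rw [add_comm t₀ s, ← integral_transition_transition_eq_of_measurable L β' κ hreal hF hM s t₀ x, hG,
      integral_sub (integrable_of_abs_le _ hκFm (C := M) fun y => abs_integral_le_of_abs_le_of_isProbabilityMeasure hM)
        (integrable_const m)]
    simp
  have hE : (∫ x, (∫ y, F y ∂(κ (t₀ + s) x)) ∂ν) - m = ∫ x, (∫ y, G y ∂(κ t₀ x)) ∂ν := by
    have hi : Integrable (fun x => ∫ y, F y ∂(κ (t₀ + s) x)) ν :=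
      integrable_of_abs_le _ ((hF.stronglyMeasurable.integral_kernel (κ := κ (t₀ + s))).measurable) (C := M)
        fun x => abs_integral_le_of_abs_le_of_isProbabilityMeasure hM
    have e1 : (∫ x, (∫ y, F y ∂(κ (t₀ + s) x)) ∂ν) - m = ∫ x, ((∫ y, F y ∂(κ (t₀ + s) x)) - m) ∂ν := by
      rw [integral_sub hi (integrable_const m)]; simp
    rw [e1]
    exact integral_congr_ae (Eventually.of_forall hCK)
  -- Jensen against `ν ≤ D μ` in `L^q`
  have hJ : |∫ x, (∫ y, G y ∂(κ t₀ x)) ∂ν| ^ q ≤ D * ∫ x, |∫ y, G y ∂(κ t₀ x)| ^ q ∂μ := by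
    have h1 : |∫ x, (∫ y, G y ∂(κ t₀ x)) ∂ν| ≤ ∫ x, |∫ y, G y ∂(κ t₀ x)| ∂ν := abs_integral_le_integral_abs
    have h2 := rpow_integral_abs_le_mul_integral_of_le_smul hD hν hKGm hKGb hq1.le
    exact (Real.rpow_le_rpow (abs_nonneg _) h1 hq0.le).trans h2
  -- hypercontractivity `2 → q` at time `t₀`
  have hHC := lqNorm_transition_le_of_generatorLogSobolev_of_measurable L β' κ hreal hρ hLSgen hGm hGb (p := 2) (by norm_num) t₀
  have eq2 : 1 + ((2 : ℝ) - 1) * Real.exp (4 * ρ * t₀) = q := by rw [hq]; ring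
  rw [eq2] at hHC
  -- the gap on `G = κ_s(F − m)`: `∫ G² dμ ≤ e^{−2λs} Var(F)`
  have hvar : ∫ x, |G x| ^ (2 : ℝ) ∂μ ≤ Real.exp (-2 * lam * s) * ∫ x, (F x - m) ^ 2 ∂μ := by
    have h1 := hgap F hF M hM s
    have e : ∫ x, |G x| ^ (2 : ℝ) ∂μ = ∫ x, ((∫ y, F y ∂(κ s x)) - m) ^ 2 ∂μ :=
      integral_congr_ae (Eventually.of_forall fun x => by simp only [hG, Real.rpow_two, sq_abs])
    rw [e, hm]; exact h1
  -- assemble: `|∫κ_{t₀}G dν| ≤ (D ∫|κ_{t₀}G|^q)^{1/q} = D^{1/q} ‖κ_{t₀}G‖_q ≤ D^{1/q} ‖G‖₂ ≤ D^{1/q} e^{−λs} √Var`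
  have hI0 : 0 ≤ ∫ x, |∫ y, G y ∂(κ t₀ x)| ^ q ∂μ := integral_nonneg fun x => Real.rpow_nonneg (abs_nonneg _) q
  have hstep1 : |∫ x, (∫ y, G y ∂(κ t₀ x)) ∂ν| ≤ (D * ∫ x, |∫ y, G y ∂(κ t₀ x)| ^ q ∂μ) ^ (1 / q) := by
    have h := Real.rpow_le_rpow (Real.rpow_nonneg (abs_nonneg _) q) hJ (by positivity : (0 : ℝ) ≤ 1 / q)
    rwa [← Real.rpow_mul (abs_nonneg _), mul_one_div_cancel hq0.ne', Real.rpow_one] at h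
  have hstep2 : (D * ∫ x, |∫ y, G y ∂(κ t₀ x)| ^ q ∂μ) ^ (1 / q) =
      D ^ (1 / q) * (∫ x, |∫ y, G y ∂(κ t₀ x)| ^ q ∂μ) ^ (1 / q) := Real.mul_rpow hD hI0
  have hstep3 : (∫ x, |∫ y, G y ∂(κ t₀ x)| ^ q ∂μ) ^ (1 / q) ≤ (∫ x, |G x| ^ (2 : ℝ) ∂μ) ^ (1 / (2 : ℝ)) := hHC
  have hstep4 : (∫ x, |G x| ^ (2 : ℝ) ∂μ) ^ (1 / (2 : ℝ)) ≤ Real.exp (-lam * s) * (∫ x, (F x - m) ^ 2 ∂μ) ^ (1 / (2 : ℝ)) := by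
    have h := Real.rpow_le_rpow (integral_nonneg fun x => Real.rpow_nonneg (abs_nonneg _) _) hvar
      (by norm_num : (0 : ℝ) ≤ 1 / 2)
    have e : (Real.exp (-2 * lam * s) * ∫ x, (F x - m) ^ 2 ∂μ) ^ (1 / (2 : ℝ)) =
        Real.exp (-lam * s) * (∫ x, (F x - m) ^ 2 ∂μ) ^ (1 / (2 : ℝ)) := by
      rw [Real.mul_rpow (Real.exp_pos _).le (integral_nonneg fun x => sq_nonneg _)]
      congr 1
      rw [← Real.exp_mul]; congr 1; ring
    rw [e] at h; exact h
  have hDq : 0 ≤ D ^ (1 / q) := Real.rpow_nonneg hD _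
  rw [hE]
  calc |∫ x, (∫ y, G y ∂(κ t₀ x)) ∂ν| ≤ (D * ∫ x, |∫ y, G y ∂(κ t₀ x)| ^ q ∂μ) ^ (1 / q) := hstep1
    _ = D ^ (1 / q) * (∫ x, |∫ y, G y ∂(κ t₀ x)| ^ q ∂μ) ^ (1 / q) := hstep2
    _ ≤ D ^ (1 / q) * (∫ x, |G x| ^ (2 : ℝ) ∂μ) ^ (1 / (2 : ℝ)) := mul_le_mul_of_nonneg_left hstep3 hDq
    _ ≤ D ^ (1 / q) * (Real.exp (-lam * s) * (∫ x, (F x - m) ^ 2 ∂μ) ^ (1 / (2 : ℝ))) :=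
        mul_le_mul_of_nonneg_left hstep4 hDq
    _ = D ^ (1 / q) * Real.exp (-lam * s) * (∫ x, (F x - m) ^ 2 ∂μ) ^ (1 / (2 : ℝ)) := by ring

/-! ## §3. The `log log D` burn-in, explicit constants -/

/-- **`D^{1/(1 + log D)} ≤ e` for `D ≥ e`** (`D^{1/log D} = e` and the exponent only decreases). [folklore] -/
theorem rpow_one_div_one_add_log_le_exp {D : ℝ} (hD : Real.exp 1 ≤ D) :
    D ^ (1 / (1 + Real.log D)) ≤ Real.exp 1 := by
  have hD1 : 1 ≤ D := le_trans (by have := Real.add_one_le_exp (1 : ℝ); linarith) hD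
  have hD0 : 0 < D := by linarith
  have hlog : 1 ≤ Real.log D := by
    have := Real.log_le_log (Real.exp_pos 1) hD
    rwa [Real.log_exp] at this
  have h1 : D ^ (1 / (1 + Real.log D)) ≤ D ^ (1 / Real.log D) :=
    Real.rpow_le_rpow_of_exponent_le hD1 (by
      rw [div_le_div_iff₀ (by linarith) (by linarith)]; linarith)
  have h2 : D ^ (1 / Real.log D) = Real.exp 1 := by
    rw [Real.rpow_def_of_pos hD0]
    congr 1
    field_simp
  rw [h2] at h1
  exact h1

/-- ★★★ **Hypercontractive `L²`-mixing of the SZZ dynamics, UNCONDITIONAL at every fixed cut-off.**  For every `L`, `β'`, every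
realising kernel family, every probability measure `ν ≤ D·μ_{β'}` with `D ≥ e`, every bounded measurable `F` and every `s ≥ 0`,
with `ρ = ½e^{−|β'|·4·#𝒫}` (log-Sobolev, Holley–Stroock), `λ = (3/2)e^{−|β'|·4·#𝒫}` (`L²` gap) and the burn-in `t₀ = log log D/(4ρ)`:

  `|∫ κ_{t₀+s}F dν − ∫ F dμ_{β'}| ≤ e · e^{−λs} · (∫ (F − μF)² dμ_{β'})^{1/2}`

— the density bound is paid as `log log D/(4ρ)` lattice time instead of the `log D/(2λ)` of the Poincaré bound
`coldStart_measurable_sq_sub_le_exp_explicit`. [cite: DiaconisSaloffcoste1996, Theorem 3.7] -/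
theorem wilson_hypercontractive_mixing_explicit (L : ℕ) [NeZero L] (β' : ℝ)
    (κ : ℝ≥0 → Kernel (GaugeConfig 3 L (Matrix.specialUnitaryGroup (Fin 2) ℂ))
      (GaugeConfig 3 L (Matrix.specialUnitaryGroup (Fin 2) ℂ))) [∀ t, IsMarkovKernel (κ t)]
    (hreal : ∀ (t : ℝ≥0) (x : GaugeConfig 3 L (Matrix.specialUnitaryGroup (Fin 2) ℂ))
        (Ω : Type) [MeasurableSpace Ω] (P : Measure Ω) [IsProbabilityMeasure P]
        (W : ℝ≥0 → Ω → (Edge 3 L × NoiseIdx 2 → ℝ)) (hW : IsFlatBrownian W P)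
        (U : ℝ≥0 → Ω → GaugeConfig 3 L (Matrix.specialUnitaryGroup (Fin 2) ℂ)),
        (∀ ω, U 0 ω = x) →
        (latticeLangevinDynamics (fundamentalLatticeRep 2) β').IsSolution (fundamentalRep (Fin 2))
          hW.natFiltration P W U →
        κ t x = P.map (U t))
    {ν : Measure (GaugeConfig 3 L (Matrix.specialUnitaryGroup (Fin 2) ℂ))} [IsProbabilityMeasure ν] {D : ℝ} (hD : Real.exp 1 ≤ D)
    (hν : ν ≤ (ENNReal.ofReal D) • wilsonMeasure (d := 3) (L := L) (fundamentalRep (Fin 2)) β')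
    {F : GaugeConfig 3 L (Matrix.specialUnitaryGroup (Fin 2) ℂ) → ℝ} (hF : Measurable F) {M : ℝ} (hM : ∀ x, |F x| ≤ M)
    (s : ℝ≥0) :
    |(∫ x, (∫ y, F y ∂(κ ((Real.log (Real.log D) / (4 * ((1 / 2 : ℝ) *
        Real.exp (-(|β'| * (4 * (Fintype.card (Plaquette 3 L) : ℝ))))))).toNNReal + s) x)) ∂ν) -
        ∫ x, F x ∂(wilsonMeasure (d := 3) (L := L) (fundamentalRep (Fin 2)) β')| ≤
      Real.exp 1 * Real.exp (-((3 / 2 : ℝ) * Real.exp (-(|β'| * (4 * (Fintype.card (Plaquette 3 L) : ℝ))))) * s) *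
        (∫ x, (F x - ∫ z, F z ∂(wilsonMeasure (d := 3) (L := L) (fundamentalRep (Fin 2)) β')) ^ 2
          ∂(wilsonMeasure (d := 3) (L := L) (fundamentalRep (Fin 2)) β')) ^ (1 / (2 : ℝ)) := by
  set ρ : ℝ := (1 / 2 : ℝ) * Real.exp (-(|β'| * (4 * (Fintype.card (Plaquette 3 L) : ℝ)))) with hρ
  have hρpos : 0 < ρ := by rw [hρ]; positivity
  have hD1 : 1 ≤ D := le_trans (by have := Real.add_one_le_exp (1 : ℝ); linarith) hD
  have hD0 : 0 ≤ D := by linarith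
  have hlog : 1 ≤ Real.log D := by
    have := Real.log_le_log (Real.exp_pos 1) hD
    rwa [Real.log_exp] at this
  have hll : 0 ≤ Real.log (Real.log D) := Real.log_nonneg hlog
  set t₀ : ℝ≥0 := (Real.log (Real.log D) / (4 * ρ)).toNNReal with ht₀
  have ht₀R : (t₀ : ℝ) = Real.log (Real.log D) / (4 * ρ) := by rw [ht₀, Real.coe_toNNReal _ (by positivity)]
  have h := abs_integral_transition_sub_le_of_hypercontractive L β' κ hreal hρpos.le
    (fun g hg => wilson_generatorLogSobolev_explicit L β' g hg)
    (lam := (3 / 2 : ℝ) * Real.exp (-(|β'| * (4 * (Fintype.card (Plaquette 3 L) : ℝ)))))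
    (fun G hG M' hM' t => wilson_spectralGap_explicit_measurable L β' κ hreal hG hM' t) hD0 hν hF hM t₀ s
  have e : 1 + Real.exp (4 * ρ * t₀) = 1 + Real.log D := by
    rw [ht₀R]
    have : 4 * ρ * (Real.log (Real.log D) / (4 * ρ)) = Real.log (Real.log D) := by field_simp
    rw [this, Real.exp_log (by linarith)]
  rw [e] at h
  have hDq := rpow_one_div_one_add_log_le_exp hD
  have hrest : 0 ≤ Real.exp (-((3 / 2 : ℝ) * Real.exp (-(|β'| * (4 * (Fintype.card (Plaquette 3 L) : ℝ))))) * s) *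
      (∫ x, (F x - ∫ z, F z ∂(wilsonMeasure (d := 3) (L := L) (fundamentalRep (Fin 2)) β')) ^ 2
        ∂(wilsonMeasure (d := 3) (L := L) (fundamentalRep (Fin 2)) β')) ^ (1 / (2 : ℝ)) :=
    mul_nonneg (Real.exp_pos _).le (Real.rpow_nonneg (integral_nonneg fun x => sq_nonneg _) _)
  calc _ ≤ _ := h
    _ ≤ _ := by
      rw [mul_assoc, mul_assoc]
      exact mul_le_mul_of_nonneg_right hDq hrest

/-- ★★★ **Volume-uniform hypercontractive `L²`-mixing at small `|β'|`.**  For every `L`, every `|β'| < 1/12`, every realising kernel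
family, every probability measure `ν ≤ D·μ_{β'}` with `D ≥ e`, every bounded measurable `F` and `s ≥ 0`, with the `L`-INDEPENDENT
constants `ρ = (1 − 12|β'|)/2` (Bakry–Émery log-Sobolev) and `λ = 1 − 12|β'|` (gap), `t₀ = log log D/(4ρ)`:

  `|∫ κ_{t₀+s}F dν − ∫ F dμ_{β'}| ≤ e · e^{−λs} · (∫ (F − μF)² dμ_{β'})^{1/2}`.

For an initial law with `log D = O(L³)` (every law of the SZZ dynamics after lattice time `2`, `map_le_smul_haar_of_le_explicit`) the
`L²`/χ²-mixing time is `log log D/(4ρ) + (1 + log(1/ε))/λ = O(log L)` — against `O(L³)` from the Poincaré inequality alone.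
[cite: DiaconisSaloffcoste1996, Theorem 3.7] [cite: ShenZhuZhu2022, Corollary 4.4] -/
theorem wilson_hypercontractive_mixing_uniform (L : ℕ) [NeZero L] (β' : ℝ) (hβ : |β'| < 1 / 12)
    (κ : ℝ≥0 → Kernel (GaugeConfig 3 L (Matrix.specialUnitaryGroup (Fin 2) ℂ))
      (GaugeConfig 3 L (Matrix.specialUnitaryGroup (Fin 2) ℂ))) [∀ t, IsMarkovKernel (κ t)]
    (hreal : ∀ (t : ℝ≥0) (x : GaugeConfig 3 L (Matrix.specialUnitaryGroup (Fin 2) ℂ))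
        (Ω : Type) [MeasurableSpace Ω] (P : Measure Ω) [IsProbabilityMeasure P]
        (W : ℝ≥0 → Ω → (Edge 3 L × NoiseIdx 2 → ℝ)) (hW : IsFlatBrownian W P)
        (U : ℝ≥0 → Ω → GaugeConfig 3 L (Matrix.specialUnitaryGroup (Fin 2) ℂ)),
        (∀ ω, U 0 ω = x) →
        (latticeLangevinDynamics (fundamentalLatticeRep 2) β').IsSolution (fundamentalRep (Fin 2))
          hW.natFiltration P W U →
        κ t x = P.map (U t))
    {ν : Measure (GaugeConfig 3 L (Matrix.specialUnitaryGroup (Fin 2) ℂ))} [IsProbabilityMeasure ν] {D : ℝ} (hD : Real.exp 1 ≤ D)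
    (hν : ν ≤ (ENNReal.ofReal D) • wilsonMeasure (d := 3) (L := L) (fundamentalRep (Fin 2)) β')
    {F : GaugeConfig 3 L (Matrix.specialUnitaryGroup (Fin 2) ℂ) → ℝ} (hF : Measurable F) {M : ℝ} (hM : ∀ x, |F x| ≤ M)
    (s : ℝ≥0) :
    |(∫ x, (∫ y, F y ∂(κ ((Real.log (Real.log D) / (4 * ((1 - 12 * |β'|) / 2))).toNNReal + s) x)) ∂ν) -
        ∫ x, F x ∂(wilsonMeasure (d := 3) (L := L) (fundamentalRep (Fin 2)) β')| ≤
      Real.exp 1 * Real.exp (-(1 - 12 * |β'|) * s) *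
        (∫ x, (F x - ∫ z, F z ∂(wilsonMeasure (d := 3) (L := L) (fundamentalRep (Fin 2)) β')) ^ 2
          ∂(wilsonMeasure (d := 3) (L := L) (fundamentalRep (Fin 2)) β')) ^ (1 / (2 : ℝ)) := by
  set ρ : ℝ := (1 - 12 * |β'|) / 2 with hρ
  have hρpos : 0 < ρ := by rw [hρ]; linarith
  have hD1 : 1 ≤ D := le_trans (by have := Real.add_one_le_exp (1 : ℝ); linarith) hD
  have hD0 : 0 ≤ D := by linarith
  have hlog : 1 ≤ Real.log D := by
    have := Real.log_le_log (Real.exp_pos 1) hD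
    rwa [Real.log_exp] at this
  have hll : 0 ≤ Real.log (Real.log D) := Real.log_nonneg hlog
  set t₀ : ℝ≥0 := (Real.log (Real.log D) / (4 * ρ)).toNNReal with ht₀
  have ht₀R : (t₀ : ℝ) = Real.log (Real.log D) / (4 * ρ) := by rw [ht₀, Real.coe_toNNReal _ (by positivity)]
  have h := abs_integral_transition_sub_le_of_hypercontractive L β' κ hreal hρpos.le
    (fun g hg => wilson_generatorLogSobolev_uniform L β' hβ g hg) (lam := 1 - 12 * |β'|)
    (fun G hG M' hM' t => wilson_spectralGap_uniform_measurable L β' hβ κ hreal hG hM' t) hD0 hν hF hM t₀ s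
  have e : 1 + Real.exp (4 * ρ * t₀) = 1 + Real.log D := by
    rw [ht₀R]
    have : 4 * ρ * (Real.log (Real.log D) / (4 * ρ)) = Real.log (Real.log D) := by field_simp
    rw [this, Real.exp_log (by linarith)]
  rw [e] at h
  have hDq := rpow_one_div_one_add_log_le_exp hD
  have hrest : 0 ≤ Real.exp (-(1 - 12 * |β'|) * s) *
      (∫ x, (F x - ∫ z, F z ∂(wilsonMeasure (d := 3) (L := L) (fundamentalRep (Fin 2)) β')) ^ 2
        ∂(wilsonMeasure (d := 3) (L := L) (fundamentalRep (Fin 2)) β')) ^ (1 / (2 : ℝ)) :=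
    mul_nonneg (Real.exp_pos _).le (Real.rpow_nonneg (integral_nonneg fun x => sq_nonneg _) _)
  calc _ ≤ _ := h
    _ ≤ _ := by
      rw [mul_assoc, mul_assoc]
      exact mul_le_mul_of_nonneg_right hDq hrest

end Summit.QuantumFields.YangMills.Theorems.ColdStartUniversality

end
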